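import Literature.NumberTheory.Rogawski1990.ArchOrbFamGExtMixedTowerBounds   -- ★ p851358 (this seat): `contDiffOn_and_forall_bound_mixedTower` (the MIXED TOWER: `C^∞` + all joint jets bounded)
import Literature.NumberTheory.Rogawski1990.ArchChartModelJetBounds          -- ★ p851340 (this seat): `exists_nhds_bddAbove_norm_iteratedFDeriv_of_chartModel`; brings ★ p851263 J1 (`exists_perm_mem_chamber`), `orbFamGExt`, `RegG`, `InRegG`
import HarnessLib

/-!
# (B3-JUNCTION, MIXED CORNER) J1-MIXED — local jet bounds of `orbFamGExt` at a mixed corner from a MIXED-TOWER MODEL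

Sub-problem `HC_CM` of `HodgeConjecture`, route `HCCMUnconditional`, crux H413 `stub_N9` (stmt-24833), LH3 leaf `F0_P3c_StubN9Direct` v5.1+, organ **O-L1d′**
`stub_N9hcCentralMixedJetBounds` = the `hCm` callback of ★ `smoothBounded_orbFamGExt_of_strata₄` (clause (I₁) of letter L1 at a MIXED corner: one compact place SCALAR,
another compact place on a noncompact FACE).  This file is the BINDER-FORM JUNCTION between the analytic engine (all ★) and the model (legs (M1)–(M3), other hands):

* §0 `exists_forall_norm_iteratedFDeriv_le_of_twoBlockSupports` — base jets of a two-block-family test function `f : P × ((Fin m₁ → M₁) × (Fin m₂ → M₂)) → F`, `C^∞` on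
  `Q ×ˢ univ` with compact block supports `C₁`, `C₂`, are bounded on `(K ∩ Q) ×ˢ univ` for every compact `K ⊆ Q` (continuity on the compact `K × C₁^{m₁} × C₂^{m₂}`, zero near
  every point off it) — the `hfbd` input of ★ `contDiffOn_and_forall_bound_mixedTower`.
* §1 HEAD `exists_nhds_bddAbove_norm_iteratedFDeriv_orbFamGExt_of_mixedModel` — DATA: the frame, real weights `hreal` at every place, a base point `x`; the face datum
  (`U(J)`, `J` the antidiagonal rank-2 form, Haar `μ₀`), the scalar datum (Haar `ν_w` on every `G_w = archLocal L 3 (diagonal α) w`, centres `ζ_w`, a slot map `e₂ : ℕ → W` of the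
  scalar places); a finite-dimensional parameter space `P` with a continuous linear chart `A` mapping a neighbourhood `U` of `x` into the open `Q`; a FACE CHART
  `Φ₁ : coords →L[ℝ] (Fin m₁ → ℝ)` vanishing at `x` and nowhere zero on `U ∩ RegG S′` (J2-MIXED: `Φ₁ c j = (c_{e₁ j, i_j} − c_{e₁ j, j_j}) ∕ 2`), a SCALAR CHART
  `Φ₂ : coords →L[ℝ] (Fin m₂ → Fin 3 → ℝ)` with `Φ₂ c k − Φ₂ x k` injective on `U ∩ RegG S′` (J2-MIXED: `Φ₂ c k l = c_{e₂ k, τ_k⁻¹ l}`); the PARTIAL MODEL `f` (`C^∞` on `Q ×ˢ univ`,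
  compact block supports `C₁ ⊆ M₂(ℂ)`, `C₂ ⊆ M₃(ℂ)` — leg (M3)); a unit `u` (`C^∞` on `U`); the MIXED MODEL IDENTITY `hfac` on `U ∩ RegG S′`:
  `orbFamGExt S′ c = u c · MIXEDTOWER_f ((A c, Φ₁ c), Φ₂ c − Φ₂ x)` (legs (M1) isolation + (M2) face descent + this seat's Fubini bookkeeping), and clause (I₂) `h1`.
  CONCLUSION: `∃ U′ ∈ 𝓝 x, BddAbove (‖Dⁿ(orbFamGExt ν′ a′ S′)‖ '' (U′ ∩ InRegG (slotSign α) S′))` — the O-L1d′ socket text at `x` once the model is supplied.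
  PROOF = ★ `contDiffOn_and_forall_bound_mixedTower` (the model is `C^∞` on `(Q × T₁^{m₁}) × T₂^{m₂}` with all jets bounded on `((K ∩ Q) × (T₁ ∩ [−½,½])^{m₁}) × (T₂ ∩ B(0,¼))^{m₂}`,
  `T₁ = {sin ≠ 0}`, `T₂ = chambers ∩ B(0,½)`) ∘ ★ `exists_nhds_bddAbove_norm_iteratedFDeriv_of_chartModel` (pull-back along `Ach = (A, Φ₁, Φ₂)`, Leibniz with `u`, density of
  `RegG`, continuity of `Dⁿ orbFamGExt` on the open `InRegG`): on the regular neighbourhood `U₀` the face angles are nonzero and small (so `sin ≠ 0`) and the centred scalar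
  angles are pairwise distinct and small (so in a chamber, ★ `exists_perm_mem_chamber`).

Harish-Chandra's theorem that `'F_f` and all its invariant derivatives are bounded on the regular set and extend continuously to the closure of each chamber
[Varadarajan1977, Part I §1.12; WarnerHASSLG2, Thm. 8.4.3.1]; Bouaziz's (I₁) [Bouaziz1994IntegralesOrbitales, §3.1 p. 579]; differentiation under the integral
[HormanderALPDO1, §1.1 Thms. 1.1.8–1.1.9].
-/

noncomputable section

open MeasureTheory MeasureTheory.Measure Set Filter Topology Function Metric NumberField NumberField.InfinitePlace
open Literature.NumberTheory.Automorphic Literature.NumberTheory.Automorphic.UnitaryGroup Literature.NumberTheory.Automorphic.ArchCartan Literature.Analysis.Calculus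
open Literature.Geometry.ComplexHyperbolic.BallModel
open scoped MatrixGroups Matrix.Norms.Operator ContDiff ENNReal Classical

namespace Literature.NumberTheory.Rogawski1990

/-! ## §0 Base jets of a two-block-family test function with compact block supports -/

section TwoBlockSupports

variable {V F : Type*} [NormedAddCommGroup V] [NormedSpace ℝ V] [NormedAddCommGroup F] [NormedSpace ℝ F]

/-- Jets vanish at a point near which the function vanishes. [cite: HormanderALPDO1, §1.1 (1.1.8)] -/
private theorem iteratedFDeriv_eq_zero_of_eventuallyEq_zero_mjm {f : V → F} {x : V} (h : f =ᶠ[𝓝 x] fun _ => 0) (k : ℕ) : iteratedFDeriv ℝ k f x = 0 := by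
  rw [(h.iteratedFDeriv ℝ k).eq_of_nhds, iteratedFDeriv_fun_zero]
  rfl

/-- **Base jets bound from compact block supports.**  A test function `f : P × ((Fin m₁ → M₁) × (Fin m₂ → M₂)) → F`, `C^∞` on `Q ×ˢ univ` (`Q` open) and vanishing as soon as
one block of the first family leaves the compact `C₁` or one block of the second family leaves the compact `C₂`, has every jet bounded on `(K ∩ Q) ×ˢ univ` for each compact
`K ⊆ Q`: `Dⁿ f` is continuous on the compact `K × C₁^{m₁} × C₂^{m₂}` and zero near every other point of `(K ∩ Q) ×ˢ univ`.  (The `hfbd` input of ★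
`contDiffOn_and_forall_bound_mixedTower`.) [cite: HormanderALPDO1, §1.1 Thm. 1.1.8] -/
theorem exists_forall_norm_iteratedFDeriv_le_of_twoBlockSupports {P M₁ M₂ : Type*} [NormedAddCommGroup P] [NormedSpace ℝ P]
    [NormedAddCommGroup M₁] [NormedSpace ℝ M₁] [NormedAddCommGroup M₂] [NormedSpace ℝ M₂] {m₁ m₂ : ℕ} {Q : Set P} (hQ : IsOpen Q)
    (f : P × ((Fin m₁ → M₁) × (Fin m₂ → M₂)) → F) (hf : ContDiffOn ℝ ∞ f (Q ×ˢ univ))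
    {C₁ : Set M₁} (hC₁ : IsCompact C₁) (hfC₁ : ∀ (q : P) (X : (Fin m₁ → M₁) × (Fin m₂ → M₂)), (∃ k, X.1 k ∉ C₁) → f (q, X) = 0)
    {C₂ : Set M₂} (hC₂ : IsCompact C₂) (hfC₂ : ∀ (q : P) (X : (Fin m₁ → M₁) × (Fin m₂ → M₂)), (∃ k, X.2 k ∉ C₂) → f (q, X) = 0)
    {K : Set P} (hK : IsCompact K) (hKQ : K ⊆ Q) (n : ℕ) :
    ∃ B : ℝ, ∀ z ∈ (K ∩ Q) ×ˢ (univ : Set ((Fin m₁ → M₁) × (Fin m₂ → M₂))), ‖iteratedFDeriv ℝ n f z‖ ≤ B := by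
  have hO : IsOpen (Q ×ˢ (univ : Set ((Fin m₁ → M₁) × (Fin m₂ → M₂)))) := hQ.prod isOpen_univ
  have hcont : ContinuousOn (fun z => ‖iteratedFDeriv ℝ n f z‖) (Q ×ˢ (univ : Set ((Fin m₁ → M₁) × (Fin m₂ → M₂)))) :=
    ((hf.continuousOn_iteratedFDerivWithin (m := n) (mod_cast le_top) hO.uniqueDiffOn).congr
      fun z hz => (iteratedFDerivWithin_of_isOpen n hO hz).symm).norm
  have hKc : IsCompact (K ×ˢ ((Set.pi univ fun _ : Fin m₁ => C₁) ×ˢ (Set.pi univ fun _ : Fin m₂ => C₂))) :=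
    hK.prod ((isCompact_univ_pi fun _ => hC₁).prod (isCompact_univ_pi fun _ => hC₂))
  obtain ⟨B, hB⟩ := hKc.exists_bound_of_continuousOn (hcont.mono (prod_mono hKQ (subset_univ _)))
  refine ⟨max B 0, fun z hz => ?_⟩
  by_cases hX : (∀ k, z.2.1 k ∈ C₁) ∧ ∀ k, z.2.2 k ∈ C₂
  · have h := hB z ⟨hz.1.1, ⟨fun k _ => hX.1 k, fun k _ => hX.2 k⟩⟩
    rw [Real.norm_eq_abs, abs_norm] at h
    exact h.trans (le_max_left _ _)
  · have hev : f =ᶠ[𝓝 z] fun _ => 0 := by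
      rw [not_and_or] at hX
      rcases hX with hX | hX
      · push Not at hX
        obtain ⟨k, hk⟩ := hX
        have hopen : IsOpen {y : P × ((Fin m₁ → M₁) × (Fin m₂ → M₂)) | y.2.1 k ∈ C₁ᶜ} :=
          hC₁.isClosed.isOpen_compl.preimage ((continuous_apply k).comp (continuous_fst.comp continuous_snd))
        filter_upwards [hopen.mem_nhds (show z ∈ {y : P × ((Fin m₁ → M₁) × (Fin m₂ → M₂)) | y.2.1 k ∈ C₁ᶜ} from hk)] with y hy
        exact hfC₁ y.1 y.2 ⟨k, hy⟩
      · push Not at hX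
        obtain ⟨k, hk⟩ := hX
        have hopen : IsOpen {y : P × ((Fin m₁ → M₁) × (Fin m₂ → M₂)) | y.2.2 k ∈ C₂ᶜ} :=
          hC₂.isClosed.isOpen_compl.preimage ((continuous_apply k).comp (continuous_snd.comp continuous_snd))
        filter_upwards [hopen.mem_nhds (show z ∈ {y : P × ((Fin m₁ → M₁) × (Fin m₂ → M₂)) | y.2.2 k ∈ C₂ᶜ} from hk)] with y hy
        exact hfC₂ y.1 y.2 ⟨k, hy⟩
    rw [iteratedFDeriv_eq_zero_of_eventuallyEq_zero_mjm hev n, norm_zero]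
    exact le_max_right _ _

end TwoBlockSupports

/-! ## §1 The head: local jet bounds at a mixed corner from a mixed-tower model -/

section Head

variable (L : Type) [Field L] [NumberField L] [IsCMField L] (α : Fin 3 → L)
  [MeasurableSpace ↥(arch (↥(maximalRealSubfield L)) L (IsCMField.complexConj L) 3 (Matrix.diagonal α))]
  [BorelSpace ↥(arch (↥(maximalRealSubfield L)) L (IsCMField.complexConj L) 3 (Matrix.diagonal α))]
  (ν' : Measure ↥(arch (↥(maximalRealSubfield L)) L (IsCMField.complexConj L) 3 (Matrix.diagonal α))) [ν'.IsHaarMeasure] [ν'.IsMulRightInvariant]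
  (a' : ↥(arch (↥(maximalRealSubfield L)) L (IsCMField.complexConj L) 3 (Matrix.diagonal α)) → ℂ)
  (S' : Finset {w : InfinitePlace L // IsComplex w})

/-- **(B3-JUNCTION, MIXED) J1-MIXED HEAD — LOCAL JET BOUNDS OF `orbFamGExt` AT A MIXED CORNER FROM A MIXED-TOWER MODEL** (see the module docstring for the data).
Given the MIXED MODEL IDENTITY `hfac` on `U ∩ RegG S′` — `orbFamGExt S′ c = u c · MIXEDTOWER_f ((A c, Φ₁ c), Φ₂ c − Φ₂ x)`, the mixed tower of ★
`contDiffOn_and_forall_bound_mixedTower` (face stage: `(∏ 2 sin ψ_k) • ∫_{U(J)^{m₁}}`, Cayley-conjugated `diag(e^{iψ_k}, e^{−iψ_k})`; central stage: `(∏ π(θ_k)) • ∫_{∏ G_{e₂ k}}`,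
conjugated `diag(ζ_{e₂ k} e^{iθ_k})`) read at the face chart `Φ₁` (zero at `x`, nowhere zero on `U ∩ RegG S′`) and the centred scalar chart `Φ₂ − Φ₂ x` (injective rows on
`U ∩ RegG S′`) —, a `C^∞` unit `u` on `U`, the partial model `f` (`C^∞` on `Q ×ˢ univ`, compact block supports) and clause (I₂) `h1`, every jet of `orbFamGExt ν′ a′ S′` is bounded
on `U′ ∩ InRegG (slotSign α) S′` for some neighbourhood `U′` of `x`.  Proof: §0 ⇒ ★ `contDiffOn_and_forall_bound_mixedTower` on `K = A(B̄(x, r∕2))`; on the regular neighbourhood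
`U₀ = B(x, r∕2) ∩ {|Φ₁| < ½} ∩ {|Φ₂ − Φ₂ x| < ¼}` the chart lands in `((K ∩ Q) × ({sin ≠ 0} ∩ [−½,½])^{m₁}) × ((chambers ∩ B(0,½)) ∩ B(0,¼))^{m₂}` (`sin ψ = 0`, `|ψ| < ½ < π`
forces `ψ = 0`; injective small angle triples lie in a chamber, ★ `exists_perm_mem_chamber`); ★ `exists_nhds_bddAbove_norm_iteratedFDeriv_of_chartModel` concludes.
[cite: WarnerHASSLG2, Thm. 8.4.3.1] [cite: Varadarajan1977, Part I §1.12] [cite: Bouaziz1994IntegralesOrbitales, §3.1 (I₁)–(I₂) p. 579] [cite: HormanderALPDO1, §1.1 Thms. 1.1.8, 1.1.9] -/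
theorem exists_nhds_bddAbove_norm_iteratedFDeriv_orbFamGExt_of_mixedModel (hα : ∀ i, α i ≠ 0)
    (hreal : ∀ (w : {w : InfinitePlace L // IsComplex w}) (i : Fin 3), (w.1.embedding (α i)).im = 0)
    {x : {w : InfinitePlace L // IsComplex w} → Fin 3 → ℝ}
    {J : Matrix (Fin 2) (Fin 2) ℂ} (hJ : J = (StdForm.antidiagonal 2).over ℂ)
    [MeasurableSpace ↥(unitaryGroupOfForm (starRingEnd ℂ) J)] [BorelSpace ↥(unitaryGroupOfForm (starRingEnd ℂ) J)]
    (μ₀ : Measure ↥(unitaryGroupOfForm (starRingEnd ℂ) J)) [μ₀.IsHaarMeasure] [μ₀.IsMulRightInvariant]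
    [∀ w : {w : InfinitePlace L // IsComplex w}, MeasurableSpace (archLocal L 3 (Matrix.diagonal α) w)]
    [∀ w : {w : InfinitePlace L // IsComplex w}, BorelSpace (archLocal L 3 (Matrix.diagonal α) w)]
    (ν : ∀ w : {w : InfinitePlace L // IsComplex w}, Measure (archLocal L 3 (Matrix.diagonal α) w))
    [∀ w : {w : InfinitePlace L // IsComplex w}, (ν w).IsHaarMeasure] [∀ w : {w : InfinitePlace L // IsComplex w}, (ν w).IsMulRightInvariant]
    (ζ : {w : InfinitePlace L // IsComplex w} → Circle) (e₂ : ℕ → {w : InfinitePlace L // IsComplex w}) (m₁ m₂ : ℕ)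
    {P : Type} [NormedAddCommGroup P] [NormedSpace ℝ P] [FiniteDimensional ℝ P] (A : ({w : InfinitePlace L // IsComplex w} → Fin 3 → ℝ) →L[ℝ] P)
    {U : Set ({w : InfinitePlace L // IsComplex w} → Fin 3 → ℝ)} (hU : U ∈ 𝓝 x) {Q : Set P} (hQ : IsOpen Q) (hAQ : MapsTo A U Q)
    (Φ₁ : ({w : InfinitePlace L // IsComplex w} → Fin 3 → ℝ) →L[ℝ] (Fin m₁ → ℝ)) (hΦ₁x : Φ₁ x = 0)
    (hΦ₁ : ∀ c ∈ U ∩ RegG S', ∀ j : Fin m₁, Φ₁ c j ≠ 0)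
    (Φ₂ : ({w : InfinitePlace L // IsComplex w} → Fin 3 → ℝ) →L[ℝ] (Fin m₂ → Fin 3 → ℝ))
    (hΦ₂ : ∀ c ∈ U ∩ RegG S', ∀ k : Fin m₂, Injective (Φ₂ c k - Φ₂ x k))
    (f : P × ((Fin m₁ → Matrix (Fin 2) (Fin 2) ℂ) × (Fin m₂ → Matrix (Fin 3) (Fin 3) ℂ)) → ℂ) (hf : ContDiffOn ℝ ∞ f (Q ×ˢ univ))
    {C₁ : Set (Matrix (Fin 2) (Fin 2) ℂ)} (hC₁ : IsCompact C₁)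
    (hfC₁ : ∀ (q : P) (X : (Fin m₁ → Matrix (Fin 2) (Fin 2) ℂ) × (Fin m₂ → Matrix (Fin 3) (Fin 3) ℂ)), (∃ k, X.1 k ∉ C₁) → f (q, X) = 0)
    {C₂ : Set (Matrix (Fin 3) (Fin 3) ℂ)} (hC₂ : IsCompact C₂)
    (hfC₂ : ∀ (q : P) (X : (Fin m₁ → Matrix (Fin 2) (Fin 2) ℂ) × (Fin m₂ → Matrix (Fin 3) (Fin 3) ℂ)), (∃ k, X.2 k ∉ C₂) → f (q, X) = 0)
    (u : ({w : InfinitePlace L // IsComplex w} → Fin 3 → ℝ) → ℂ) (hu : ContDiffOn ℝ ∞ u U)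
    (hfac : ∀ c ∈ U ∩ RegG S', orbFamGExt L α ν' a' S' c =
      u c * ((∏ k : Fin m₂, rootProduct ((Φ₂ c - Φ₂ x) k)) • ∫ g : ((k : Fin m₂) → archLocal L 3 (Matrix.diagonal α) (e₂ k.val)),
          (fun z' : (P × (Fin m₁ → ℝ)) × (Fin m₂ → Matrix (Fin 3) (Fin 3) ℂ) =>
        ((∏ k : Fin m₁, 2 * Real.sin (z'.1.2 k)) • ∫ h : Fin m₁ → ↥(unitaryGroupOfForm (starRingEnd ℂ) J),
          (fun y : (P × (Fin m₂ → Matrix (Fin 3) (Fin 3) ℂ)) × (Fin m₁ → Matrix (Fin 2) (Fin 2) ℂ) => f (y.1.1, (y.2, y.1.2))) ((z'.1.1, z'.2), fun k => (((h k * ⟨Matrix.GeneralLinearGroup.mkOfDetNeZero !![(1 : ℂ), 1; 1, -1] det_cayleyTwo_ne_zero * circleDiagonal 2 ![Circle.exp (z'.1.2 k), Circle.exp (-(z'.1.2 k))] * (Matrix.GeneralLinearGroup.mkOfDetNeZero !![(1 : ℂ), 1; 1, -1] det_cayleyTwo_ne_zero)⁻¹, cayley_conj_circleDiagonal_mem_of_eq_over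 hJ _⟩ * (h k)⁻¹ : ↥(unitaryGroupOfForm (starRingEnd ℂ) J)) : GL (Fin 2) ℂ) : Matrix (Fin 2) (Fin 2) ℂ)) ∂(Measure.pi fun _ : Fin m₁ => μ₀))) ((A c, Φ₁ c), fun k => (((g k * (⟨circleDiagonal 3 (fun i => ζ (e₂ k.val) * Circle.exp ((Φ₂ c - Φ₂ x) k i)), circleDiagonal_mem_archLocal_diagonal L 3 α (e₂ k.val) _⟩ : archLocal L 3 (Matrix.diagonal α) (e₂ k.val)) * (g k)⁻¹ : archLocal L 3 (Matrix.diagonal α) (e₂ k.val)) : GL (Fin 3) ℂ) : Matrix (Fin 3) (Fin 3) ℂ)) ∂(Measure.pi fun k : Fin m₂ => ν (e₂ k.val))))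
    (h1 : ContDiffOn ℝ ∞ (orbFamGExt L α ν' a' S') (InRegG (slotSign L α) S')) (n : ℕ) :
    ∃ U' ∈ 𝓝 x, BddAbove ((fun c => ‖iteratedFDeriv ℝ n (orbFamGExt L α ν' a' S') c‖) '' (U' ∩ InRegG (slotSign L α) S')) := by
  have hxU : x ∈ U := mem_of_mem_nhds hU
  -- STEP 1: a ball around `x` inside `U ∩ A⁻¹' Q`; the compact `K = A '' closedBall x (r/2) ⊆ Q`; base jets bounded on `(K ∩ Q) ×ˢ univ` (§0)
  have hpreQ : A ⁻¹' Q ∈ 𝓝 x := (hQ.preimage A.continuous).mem_nhds (hAQ hxU)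
  obtain ⟨r, hr, hrUQ⟩ := Metric.mem_nhds_iff.1 (inter_mem hU hpreQ)
  have hr2 : 0 < r / 2 := half_pos hr
  set K : Set P := A '' closedBall x (r / 2) with hK
  have hKc : IsCompact K := (isCompact_closedBall x (r / 2)).image A.continuous
  have hKQ : K ⊆ Q := by
    rintro _ ⟨c, hc, rfl⟩
    exact (hrUQ (closedBall_subset_ball (half_lt_self hr) hc)).2
  have hfbd : ∀ k : ℕ, ∃ B : ℝ, ∀ z ∈ (K ∩ Q) ×ˢ (univ : Set ((Fin m₁ → Matrix (Fin 2) (Fin 2) ℂ) × (Fin m₂ → Matrix (Fin 3) (Fin 3) ℂ))), ‖iteratedFDeriv ℝ k f z‖ ≤ B :=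
    fun k => exists_forall_norm_iteratedFDeriv_le_of_twoBlockSupports hQ f hf hC₁ hfC₁ hC₂ hfC₂ hKc hKQ k
  -- STEP 2: the model `Ψ` = the mixed tower of `f`; smooth on `O'`, all jets bounded on `R` (★ `contDiffOn_and_forall_bound_mixedTower`)
  obtain ⟨Ψ, hΨdef⟩ : ∃ Ψ : (P × (Fin m₁ → ℝ)) × (Fin m₂ → Fin 3 → ℝ) → ℂ, Ψ = fun z : (P × (Fin m₁ → ℝ)) × (Fin m₂ → Fin 3 → ℝ) =>
      ((∏ k : Fin m₂, rootProduct (z.2 k)) • ∫ g : ((k : Fin m₂) → archLocal L 3 (Matrix.diagonal α) (e₂ k.val)),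
          (fun z' : (P × (Fin m₁ → ℝ)) × (Fin m₂ → Matrix (Fin 3) (Fin 3) ℂ) =>
        ((∏ k : Fin m₁, 2 * Real.sin (z'.1.2 k)) • ∫ h : Fin m₁ → ↥(unitaryGroupOfForm (starRingEnd ℂ) J),
          (fun y : (P × (Fin m₂ → Matrix (Fin 3) (Fin 3) ℂ)) × (Fin m₁ → Matrix (Fin 2) (Fin 2) ℂ) => f (y.1.1, (y.2, y.1.2))) ((z'.1.1, z'.2), fun k => (((h k * ⟨Matrix.GeneralLinearGroup.mkOfDetNeZero !![(1 : ℂ), 1; 1, -1] det_cayleyTwo_ne_zero * circleDiagonal 2 ![Circle.exp (z'.1.2 k), Circle.exp (-(z'.1.2 k))] * (Matrix.GeneralLinearGroup.mkOfDetNeZero !![(1 : ℂ), 1; 1, -1] det_cayleyTwo_ne_zero)⁻¹, cayley_conj_circleDiagonal_mem_of_eq_over hJ _⟩ * (h k)⁻¹ : ↥(unitaryGroupOfForm (starRingEnd ℂ) J)) : GL (Fin 2) ℂ) : Matrix (Fin 2) (Fin 2) ℂ)) ∂(Measure.pi fun _ : Fin m₁ => μ₀))) (z.1, fun k => (((g k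 * (⟨circleDiagonal 3 (fun i => ζ (e₂ k.val) * Circle.exp ((z.2 k) i)), circleDiagonal_mem_archLocal_diagonal L 3 α (e₂ k.val) _⟩ : archLocal L 3 (Matrix.diagonal α) (e₂ k.val)) * (g k)⁻¹ : archLocal L 3 (Matrix.diagonal α) (e₂ k.val)) : GL (Fin 3) ℂ) : Matrix (Fin 3) (Fin 3) ℂ)) ∂(Measure.pi fun k : Fin m₂ => ν (e₂ k.val))) := ⟨_, rfl⟩
  set T₁ : Set ℝ := {ψ : ℝ | Real.sin ψ ≠ 0} with hT₁
  set T₂ : Set (Fin 3 → ℝ) := {θ : Fin 3 → ℝ | ∃ σ : Equiv.Perm (Fin 3), θ (σ 0) < θ (σ 1) ∧ θ (σ 1) < θ (σ 2)} ∩ ball (0 : Fin 3 → ℝ) (1 / 2) with hT₂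
  have hT₁o : IsOpen T₁ := isOpen_ne_fun Real.continuous_sin continuous_const
  have hT₂o : IsOpen T₂ := by
    have hopen : IsOpen {θ : Fin 3 → ℝ | ∃ σ : Equiv.Perm (Fin 3), θ (σ 0) < θ (σ 1) ∧ θ (σ 1) < θ (σ 2)} := by
      rw [Set.setOf_exists]; exact isOpen_iUnion fun σ => isOpen_chamber σ
    exact hopen.inter isOpen_ball
  set O' : Set ((P × (Fin m₁ → ℝ)) × (Fin m₂ → Fin 3 → ℝ)) := (Q ×ˢ Set.pi univ fun _ => T₁) ×ˢ Set.pi univ fun _ => T₂ with hO'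
  have hO'o : IsOpen O' := (hQ.prod (isOpen_set_pi finite_univ fun _ _ => hT₁o)).prod (isOpen_set_pi finite_univ fun _ _ => hT₂o)
  set R : Set ((P × (Fin m₁ → ℝ)) × (Fin m₂ → Fin 3 → ℝ)) :=
    ((K ∩ Q) ×ˢ Set.pi univ (fun _ => T₁ ∩ Icc (-(1 / 2 : ℝ)) (1 / 2))) ×ˢ Set.pi univ (fun _ => T₂ ∩ ball (0 : Fin 3 → ℝ) (1 / 4)) with hR
  have hRO : R ⊆ O' :=
    prod_mono (prod_mono inter_subset_right (pi_mono fun _ _ => inter_subset_left)) (pi_mono fun _ _ => inter_subset_left)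
  have hmain := contDiffOn_and_forall_bound_mixedTower (E := ℂ) hJ μ₀ L α ν ζ hα hreal e₂ m₁ m₂ P hQ f hf hC₁ hfC₁ hC₂ hfC₂ K hfbd
  have hΨs : ContDiffOn ℝ ∞ Ψ O' := by
    rw [hΨdef]; exact hmain.1
  have hΨb : ∀ k : ℕ, ∃ B : ℝ, ∀ z ∈ R, ‖iteratedFDeriv ℝ k Ψ z‖ ≤ B := by
    rw [hΨdef]; exact hmain.2
  -- STEP 3: the chart `Ach = (A, Φ₁, Φ₂)` and the translation `p₀ = ((0, 0), −Φ₂ x)`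
  set Ach : ({w : InfinitePlace L // IsComplex w} → Fin 3 → ℝ) →L[ℝ] (P × (Fin m₁ → ℝ)) × (Fin m₂ → Fin 3 → ℝ) := (A.prod Φ₁).prod Φ₂ with hAch
  set p₀ : (P × (Fin m₁ → ℝ)) × (Fin m₂ → Fin 3 → ℝ) := ((0, 0), -(Φ₂ x)) with hp₀
  have hAchp : ∀ c, Ach c + p₀ = ((A c, Φ₁ c), Φ₂ c - Φ₂ x) := fun c => by
    rw [hAch, hp₀, ContinuousLinearMap.prod_apply, ContinuousLinearMap.prod_apply, Prod.mk_add_mk, Prod.mk_add_mk, add_zero, add_zero, sub_eq_add_neg]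
  -- STEP 4: the regular neighbourhood `U₀` and the landing `hmaps`
  set U₀ : Set ({w : InfinitePlace L // IsComplex w} → Fin 3 → ℝ) :=
    ball x (r / 2) ∩ Φ₁ ⁻¹' (Set.pi univ fun _ : Fin m₁ => Ioo (-(1 / 2 : ℝ)) (1 / 2)) ∩ (fun c => Φ₂ c - Φ₂ x) ⁻¹' (Set.pi univ fun _ : Fin m₂ => ball (0 : Fin 3 → ℝ) (1 / 4)) with hU₀
  have hU₀o : IsOpen U₀ :=
    (isOpen_ball.inter ((isOpen_set_pi finite_univ fun _ _ => isOpen_Ioo).preimage Φ₁.continuous)).inter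
      ((isOpen_set_pi finite_univ fun _ _ => isOpen_ball).preimage (Φ₂.continuous.sub continuous_const))
  have hxU₀ : x ∈ U₀ := by
    refine ⟨⟨mem_ball_self hr2, fun j _ => ?_⟩, fun k _ => ?_⟩
    · rw [hΦ₁x]
      exact ⟨by norm_num, by norm_num⟩
    · show (Φ₂ x - Φ₂ x) k ∈ ball (0 : Fin 3 → ℝ) (1 / 4)
      rw [sub_self]
      exact mem_ball_self (by norm_num)
  have hU₀U : U₀ ⊆ U := fun c hc => (hrUQ (ball_subset_ball (half_le_self hr.le) hc.1.1)).1
  have hmaps : ∀ c ∈ U₀ ∩ RegG S', Ach c + p₀ ∈ R := by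
    rintro c ⟨hcU₀, hcreg⟩
    have hcU : c ∈ U := hU₀U hcU₀
    rw [hAchp c]
    refine ⟨⟨⟨⟨c, ball_subset_closedBall hcU₀.1.1, rfl⟩, (hrUQ (ball_subset_ball (half_le_self hr.le) hcU₀.1.1)).2⟩, fun j _ => ?_⟩, fun k _ => ?_⟩
    · have hj : Φ₁ c j ∈ Ioo (-(1 / 2 : ℝ)) (1 / 2) := hcU₀.1.2 j (mem_univ _)
      refine ⟨?_, ⟨hj.1.le, hj.2.le⟩⟩
      show Real.sin (Φ₁ c j) ≠ 0
      intro h0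
      have hlt1 : -Real.pi < Φ₁ c j := by linarith [hj.1, Real.pi_gt_three]
      have hlt2 : Φ₁ c j < Real.pi := by linarith [hj.2, Real.pi_gt_three]
      exact hΦ₁ c ⟨hcU, hcreg⟩ j ((Real.sin_eq_zero_iff_of_lt_of_lt hlt1 hlt2).1 h0)
    · have hk : (Φ₂ c - Φ₂ x) k ∈ ball (0 : Fin 3 → ℝ) (1 / 4) := hcU₀.2 k (mem_univ _)
      have hinj : Injective ((Φ₂ c - Φ₂ x) k) := hΦ₂ c ⟨hcU, hcreg⟩ k
      obtain ⟨σ, hσ⟩ := exists_perm_mem_chamber hinj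
      exact ⟨⟨⟨σ, hσ⟩, ball_subset_ball (by norm_num) hk⟩, hk⟩
  -- STEP 5: the model identity in chart form, and the junction ★ `exists_nhds_bddAbove_norm_iteratedFDeriv_of_chartModel`
  have hfac' : ∀ c ∈ U ∩ U₀ ∩ RegG S', orbFamGExt L α ν' a' S' c = u c * Ψ (Ach c + p₀) := by
    rintro c ⟨⟨hcU, -⟩, hcreg⟩
    rw [hAchp c, hΨdef]
    exact hfac c ⟨hcU, hcreg⟩
  exact exists_nhds_bddAbove_norm_iteratedFDeriv_of_chartModel (slotSign L α) S' (orbFamGExt L α ν' a' S') h1 Ach p₀ hO'o Ψ hΨs R hRO hΨb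
    hU₀o hxU₀ hmaps hU u hu hfac' n

end Head

end Literature.NumberTheory.Rogawski1990

end
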